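import Literature.Analysis.FluidPDE.KNSSLineInvariantLiouville
import Literature.Analysis.FluidPDE.LeiRenZhang2019SlidingVelocity
import Literature.Analysis.FluidPDE.BoundedWeakIsometry
import HarnessLib

/-!
# Blow-up scenario census, block A: the 2.5D cell in the printed bounded-weak class (row A7b)

Cell `pub/ns-census` (director-ns KEY req102, D-0154 (A), 2026-08-28), typer seat `ns-census-typer-2`
(generation 4). Companion of `ScenarioCensusAncientPlanarSymmetry.lean` (`row_A7_excluded`, census row A7 in
the duality class); this file closes the PRINTED-CLASS twin of that cell (pattern of rows A3b / A4b / A6b):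

* `repr_const_of_ae_lineInvariant` — the engine (steps (3)–(6) of `ae_eq_const_of_lineInvariant_of_measurable`,
  isolated for reuse): the §4 representative `U` of a bounded weak solution
  (`KNSS2009_regularity_boundedWeak_ancient_holds`) whose slices are invariant under `x ↦ x + δe₁` at a.e.
  time is constant in space at every `t < 0` (modification on a measurable null set of times —
  `IsBoundedWeakNSSolutionOn.congr_ae` —, slice-continuous descent
  `IsBoundedWeakNSSolutionOn.planarProj_trace_of_lineInvariant`, Theorem 5.1 `KNSS2009_liouville_planar_holds`,
  Lipschitz continuity of `∇U` in `t`, `repr_const_of_planar_const`);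
* `boundedWeak_ae_eq_const_of_ae_lineInvariant` / `…_of_ae_invariant_along` — KNSS's Theorem 5.1 one
  dimension up in the printed class `L^∞(ℝ³ × (−∞, 0))` of §4 (ii) (the statement used on p. 13, proof of
  Thm 6.2): a bounded weak solution invariant along a line as an `L^∞` function is `b(t)` a.e. for a.e. `t`;
* `Row_A7b` / `row_A7b_excluded` — the census row (direction `e₃`). Value: EXCLUDED-IN-TREE.

All inputs are DISCHARGED tree theorems. No summit statement is proved or claimed here; nothing in this file
is a claim about Navier–Stokes regularity.

References: G. Koch, N. Nadirashvili, G. Seregin, V. Šverák, Acta Math. 203 (2009) 83–105 =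
arXiv:0709.3599, Thm 5.1 (p. 9), §4 (ii) (p. 8), Lemma 2.1 (p. 5), proof of Thm 6.2 (p. 13);
A. J. Majda, A. L. Bertozzi, *Vorticity and Incompressible Flow*, CUP 2002, §2.3.1.
-/

noncomputable section

set_option linter.dupNamespace false

open MeasureTheory Set Function Filter Topology WithLp
open scoped RealInnerProductSpace ContDiff Laplacian

namespace Summit.NavierStokesRegularity.NavierStokesRegularity.Theorems.ScenarioCensus

open Literature.Analysis Literature.Analysis.FluidPDE

/-! ## The §4 representative of a line-invariant bounded weak solution is constant in space -/

/-- A point of `ℝ³` is its trace on the plane `x₁ = 0` plus its `e₁`-component. -/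
private theorem eq_planarPoint_add_single_census' (x : EuclideanSpace ℝ (Fin 3)) :
    x = (toLp 2 ![x 0, 0, x 2] : EuclideanSpace ℝ (Fin 3)) + EuclideanSpace.single 1 (x 1) := by
  ext j
  fin_cases j <;> simp

/-- **The §4 representative of a line-invariant bounded weak ancient solution is constant in space**: for a
bounded weak solution `ũ` (KNSS 2009 §4 (ii), `ν = 1`, on `ℝ³ × (−∞, 0)`) with §4 representative `U + b(t)`
(clauses of `KNSS2009_regularity_boundedWeak_ancient`) whose slices `U(t, ·)` are invariant under
`x ↦ x + δe₁` at a.e. `t < 0`, `U(t, x) = U(t, 0)` for every `t < 0` (modification on a null set of times,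
slice-continuous descent, Thm 5.1, Lipschitz continuity of `∇U` in `t`, `repr_const_of_planar_const`). -/
theorem repr_const_of_ae_lineInvariant
    {ũ U : ℝ → EuclideanSpace ℝ (Fin 3) → EuclideanSpace ℝ (Fin 3)} {b : ℝ → EuclideanSpace ℝ (Fin 3)}
    (hw : IsBoundedWeakNSSolutionOn (Iio 0) isOpen_Iio 1 ũ)
    (hbm : Measurable b) (hbC : ∃ C : ℝ, ∀ t, ‖b t‖ ≤ C) (hUm : Measurable (uncurry U))
    (hae : ∀ᵐ t ∂((volume : Measure ℝ).restrict (Iio 0)), ũ t =ᵐ[volume] fun x => U t x + b t)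
    (hsmooth : ∀ t < 0, ContDiff ℝ ∞ (U t))
    (hdivU : ∀ t < 0, VectorCalculus.IsDivFree (U t))
    (hbd : ∀ k : ℕ, ∃ C : ℝ, ∀ t < 0, ∀ x, ‖iteratedFDeriv ℝ k (U t) x‖ ≤ C)
    (hlip : ∀ k : ℕ, 1 ≤ k → ∃ L : ℝ, ∀ s < 0, ∀ t < 0, ∀ x,
      ‖iteratedFDeriv ℝ k (U t) x - iteratedFDeriv ℝ k (U s) x‖ ≤ L * |t - s|)
    (hvort : ∀ x, ∀ s t : ℝ, s ≤ t → t < 0 →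
      curl (U t) x - curl (U s) x =
        ∫ τ in s..t, ((Δ (curl (U τ))) x - fderiv ℝ (curl (U τ)) x (U τ x + b τ) +
          fderiv ℝ (U τ) x (curl (U τ) x)))
    (hUinv : ∀ᵐ t ∂((volume : Measure ℝ).restrict (Iio 0)),
      ∀ (x : EuclideanSpace ℝ (Fin 3)) (δ : ℝ), U t (x + EuclideanSpace.single 1 δ) = U t x) :
    ∀ t < 0, ∀ x : EuclideanSpace ℝ (Fin 3), U t x = U t 0 := by
  classical
  obtain ⟨C0, hC0⟩ := hbd 0
  obtain ⟨Cb, hCb⟩ := id hbC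
  have hUb : ∀ t < 0, ∀ x, ‖U t x‖ ≤ C0 := fun t ht x => by
    have h := hC0 t ht x
    rwa [norm_iteratedFDeriv_zero] at h
  have hC0nn : 0 ≤ C0 := (norm_nonneg _).trans (hUb (-1) (by norm_num) 0)
  have hUc : ∀ t < 0, Continuous (U t) := fun t ht => (hsmooth t ht).continuous
  -- a measurable conull set of good times
  obtain ⟨T₀, hT₀m, hT₀sub, hT₀ae⟩ : ∃ T₀ : Set ℝ, MeasurableSet T₀ ∧
      (∀ t ∈ T₀, t < 0 ∧ (ũ t =ᵐ[volume] fun x => U t x + b t) ∧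
        ∀ (x : EuclideanSpace ℝ (Fin 3)) (δ : ℝ), U t (x + EuclideanSpace.single 1 δ) = U t x) ∧
      ∀ᵐ t ∂((volume : Measure ℝ).restrict (Iio 0)), t ∈ T₀ := by
    set μ : Measure ℝ := (volume : Measure ℝ).restrict (Iio 0) with hμ
    set Pg : ℝ → Prop := fun t => t < 0 ∧ (ũ t =ᵐ[volume] fun x => U t x + b t) ∧
        ∀ (x : EuclideanSpace ℝ (Fin 3)) (δ : ℝ), U t (x + EuclideanSpace.single 1 δ) = U t x with hPg
    have hgood : ∀ᵐ t ∂μ, Pg t := by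
      filter_upwards [ae_restrict_mem measurableSet_Iio, hae, hUinv] with t h1 h2 h3
      exact ⟨h1, h2, h3⟩
    have hB : μ {t | ¬ Pg t} = 0 := ae_iff.1 hgood
    refine ⟨(toMeasurable μ {t | ¬ Pg t})ᶜ, (measurableSet_toMeasurable _ _).compl, ?_, ?_⟩
    · intro t ht
      by_contra hcon
      exact ht (subset_toMeasurable μ {t | ¬ Pg t} hcon)
    · exact measure_eq_zero_iff_ae_notMem.1 (by rw [measure_toMeasurable]; exact hB)
  -- the representative modified on the null set of bad times
  set U' : ℝ → EuclideanSpace ℝ (Fin 3) → EuclideanSpace ℝ (Fin 3) :=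
    fun t => if t ∈ T₀ then U t else 0 with hU'_def
  have hU'T : ∀ t ∈ T₀, U' t = U t := fun t ht => by simp [hU'_def, ht]
  have hU'n : ∀ t ∉ T₀, U' t = 0 := fun t ht => by simp [hU'_def, ht]
  have hU'm : Measurable (uncurry U') := by
    have h1 : uncurry U' = fun p : ℝ × EuclideanSpace ℝ (Fin 3) =>
        if p.1 ∈ T₀ then U p.1 p.2 else 0 := by
      funext p; by_cases hp : p.1 ∈ T₀ <;> simp [uncurry, hU'_def, hp]
    rw [h1]
    exact Measurable.ite (measurable_fst hT₀m) hUm measurable_const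
  have hU'c : ∀ t, Continuous (U' t) := fun t => by
    by_cases ht : t ∈ T₀
    · rw [hU'T t ht]; exact hUc t (hT₀sub t ht).1
    · rw [hU'n t ht]; exact continuous_const
  have hU'b : ∀ t x, ‖U' t x‖ ≤ C0 := fun t x => by
    by_cases ht : t ∈ T₀
    · rw [hU'T t ht]; exact hUb t (hT₀sub t ht).1 x
    · rw [hU'n t ht]; simpa using hC0nn
  have hU'inv : ∀ t, ∀ (x : EuclideanSpace ℝ (Fin 3)) (δ : ℝ),
      U' t (x + EuclideanSpace.single 1 δ) = U' t x := fun t x δ => by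
    by_cases ht : t ∈ T₀
    · rw [hU'T t ht]; exact (hT₀sub t ht).2.2 x δ
    · rw [hU'n t ht]; rfl
  have hU'div : ∀ t, IsWeaklyDivFree (U' t) := fun t => by
    by_cases ht : t ∈ T₀
    · rw [hU'T t ht]
      exact VectorCalculus.IsDivFree.isWeaklyDivFree_holds (hdivU t (hT₀sub t ht).1)
        ((hsmooth t (hT₀sub t ht).1).of_le (natCast_le_contDiff_infty 1))
    · rw [hU'n t ht]
      intro θ _
      simp
  -- `w = U' + b` is a bounded weak solution (it equals `ũ` a.e. on the slab)
  set w : ℝ → EuclideanSpace ℝ (Fin 3) → EuclideanSpace ℝ (Fin 3) := fun t x => U' t x + b t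
    with hw_def
  have hwW : IsBoundedWeakNSSolutionOn (Iio 0) isOpen_Iio 1 w := by
    refine hw.congr_ae ?_ ⟨C0 + Cb, fun t _ x => ?_⟩ ?_
    · have h1 : uncurry w = fun p : ℝ × EuclideanSpace ℝ (Fin 3) => uncurry U' p + b p.1 := by
        funext p; rfl
      rw [h1]
      exact (hU'm.add (hbm.comp measurable_fst)).aestronglyMeasurable
    · exact (norm_add_le _ _).trans (add_le_add (hU'b t x) (hCb t))
    · filter_upwards [hT₀ae] with t ht
      obtain ⟨-, hũ, -⟩ := hT₀sub t ht
      have h1 : w t = fun x => U t x + b t := funext fun x => by simp [hw_def, hU'T t ht]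
      rw [h1]
      exact hũ.symm
  -- descent to the plane `x₁ = 0` and Theorem 5.1
  set P : EuclideanSpace ℝ (Fin 3) →L[ℝ] EuclideanSpace ℝ (Fin 2) :=
    (EuclideanSpace.proj (0 : Fin 3)).smulRight (EuclideanSpace.single (0 : Fin 2) (1 : ℝ)) +
      (EuclideanSpace.proj (2 : Fin 3)).smulRight (EuclideanSpace.single (1 : Fin 2) (1 : ℝ))
    with hPdef
  set L : EuclideanSpace ℝ (Fin 2) →L[ℝ] EuclideanSpace ℝ (Fin 3) :=
    (EuclideanSpace.proj (0 : Fin 2)).smulRight (EuclideanSpace.single (0 : Fin 3) (1 : ℝ)) +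
      (EuclideanSpace.proj (1 : Fin 2)).smulRight (EuclideanSpace.single (2 : Fin 3) (1 : ℝ))
    with hLdef
  have hP : ∀ v : EuclideanSpace ℝ (Fin 3), P v = toLp 2 ![v 0, v 2] := by
    intro v; rw [hPdef]; ext j; fin_cases j <;> simp
  have hL : ∀ y : EuclideanSpace ℝ (Fin 2), L y = toLp 2 ![y 0, 0, y 1] := by
    intro y; rw [hLdef]; ext j; fin_cases j <;> simp
  have hwc : ∀ t ∈ Iio (0 : ℝ), Continuous (w t) := fun t _ => (hU'c t).add continuous_const
  have hwinv : ∀ t ∈ Iio (0 : ℝ), ∀ (x : EuclideanSpace ℝ (Fin 3)) (δ : ℝ),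
      w t (x + EuclideanSpace.single 1 δ) = w t x := fun t _ x δ => by simp only [hw_def, hU'inv t x δ]
  have hwdiv : ∀ t ∈ Iio (0 : ℝ), IsWeaklyDivFree (w t) := fun t _ => (hU'div t).add_const _
  have hVm : AEStronglyMeasurable (uncurry fun t y => P (w t (L y)))
      (volume.restrict (Iio (0 : ℝ) ×ˢ univ)) := by
    have h1 : Measurable (uncurry fun t (y : EuclideanSpace ℝ (Fin 2)) => P (w t (L y))) := by
      have hUL : Measurable fun p : ℝ × EuclideanSpace ℝ (Fin 2) => uncurry U' (p.1, L p.2) :=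
        hU'm.comp (measurable_fst.prodMk (L.continuous.measurable.comp measurable_snd))
      have hbL : Measurable fun p : ℝ × EuclideanSpace ℝ (Fin 2) => b p.1 := hbm.comp measurable_fst
      have h2 : (uncurry fun t (y : EuclideanSpace ℝ (Fin 2)) => P (w t (L y))) =
          fun p => P (uncurry U' (p.1, L p.2) + b p.1) := by
        funext p; rfl
      rw [h2]
      exact P.continuous.measurable.comp (hUL.add hbL)
    exact h1.aestronglyMeasurable
  have hV := hwW.planarProj_trace_of_lineInvariant hP hL hwc hVm hwinv hwdiv
  obtain ⟨β, -, -, hβ⟩ := KNSS2009_liouville_planar_holds hV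
  -- the planar components of `U t` are constant in space, for a.e. `t`
  have hplae : ∀ᵐ t ∂((volume : Measure ℝ).restrict (Iio 0)),
      ∀ x : EuclideanSpace ℝ (Fin 3), U t x 0 = U t 0 0 ∧ U t x 2 = U t 0 2 := by
    filter_upwards [hβ, hT₀ae] with t ht hT
    obtain ⟨htneg, -, hinvU⟩ := hT₀sub t hT
    have hwt : ∀ x, w t x = U t x + b t := fun x => by simp [hw_def, hU'T t hT]
    have h0 : (fun y : EuclideanSpace ℝ (Fin 2) => U t (L y) 0) =ᵐ[volume]
        fun _ => β t 0 - b t 0 := by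
      filter_upwards [ht] with y hy
      have := congr_arg (fun v : EuclideanSpace ℝ (Fin 2) => v 0) hy
      have h' : U t (L y) 0 + b t 0 = β t 0 := by simpa [hP, hwt] using this
      linarith
    have h2 : (fun y : EuclideanSpace ℝ (Fin 2) => U t (L y) 2) =ᵐ[volume]
        fun _ => β t 1 - b t 2 := by
      filter_upwards [ht] with y hy
      have := congr_arg (fun v : EuclideanSpace ℝ (Fin 2) => v 1) hy
      have h' : U t (L y) 2 + b t 2 = β t 1 := by simpa [hP, hwt] using this
      linarith
    have hc0 : Continuous fun y : EuclideanSpace ℝ (Fin 2) => U t (L y) 0 :=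
      (EuclideanSpace.proj (0 : Fin 3)).continuous.comp ((hUc t htneg).comp L.continuous)
    have hc2 : Continuous fun y : EuclideanSpace ℝ (Fin 2) => U t (L y) 2 :=
      (EuclideanSpace.proj (2 : Fin 3)).continuous.comp ((hUc t htneg).comp L.continuous)
    have e0 := Measure.eq_of_ae_eq h0 hc0 continuous_const
    have e2 := Measure.eq_of_ae_eq h2 hc2 continuous_const
    have key : ∀ x : EuclideanSpace ℝ (Fin 3), U t x = U t (L (toLp 2 ![x 0, x 2])) := by
      intro x
      have hx : L (toLp 2 ![x 0, x 2]) = toLp 2 ![x 0, 0, x 2] := by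
        rw [hL]; ext j; fin_cases j <;> simp
      rw [hx]
      conv_lhs => rw [eq_planarPoint_add_single_census' x]
      exact hinvU _ _
    intro x
    refine ⟨?_, ?_⟩
    · rw [key x, key 0]
      have a1 := congr_fun e0 (toLp 2 ![x 0, x 2])
      have a2 := congr_fun e0 (toLp 2 ![(0 : EuclideanSpace ℝ (Fin 3)) 0, (0 : EuclideanSpace ℝ (Fin 3)) 2])
      simp only at a1 a2
      rw [a1, a2]
    · rw [key x, key 0]
      have a1 := congr_fun e2 (toLp 2 ![x 0, x 2])
      have a2 := congr_fun e2 (toLp 2 ![(0 : EuclideanSpace ℝ (Fin 3)) 0, (0 : EuclideanSpace ℝ (Fin 3)) 2])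
      simp only at a1 a2
      rw [a1, a2]
  -- every `t < 0`: the increments `U(s, x) − U(s, 0)` are continuous in `s`
  obtain ⟨L1, hL1⟩ := hlip 1 le_rfl
  have hincr : ∀ x : EuclideanSpace ℝ (Fin 3), ContinuousOn (fun s => U s x - U s 0) (Iio 0) := by
    intro x
    refine continuousOn_of_norm_sub_le_mul (L := L1 * ‖x - 0‖) fun s hs s' hs' => ?_
    have hd : Differentiable ℝ (U s' - U s) :=
      ((hsmooth s' hs').sub (hsmooth s hs)).differentiable (by simp)
    have hbound : ∀ z, ‖fderiv ℝ (U s' - U s) z‖ ≤ L1 * |s' - s| := fun z => by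
      rw [norm_fderiv_eq_norm_iteratedFDeriv_one,
        iteratedFDeriv_sub_apply ((hsmooth s' hs').of_le (natCast_le_contDiff_infty 1)).contDiffAt
          ((hsmooth s hs).of_le (natCast_le_contDiff_infty 1)).contDiffAt]
      exact hL1 s hs s' hs' z
    have hmv := (convex_univ (𝕜 := ℝ) (E := EuclideanSpace ℝ (Fin 3))).norm_image_sub_le_of_norm_fderiv_le
      (fun z _ => hd.differentiableAt) (fun z _ => hbound z) (mem_univ 0) (mem_univ x)
    calc ‖(U s' x - U s' 0) - (U s x - U s 0)‖ = ‖(U s' - U s) x - (U s' - U s) 0‖ := by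
          congr 1; simp only [Pi.sub_apply]; abel
      _ ≤ L1 * |s' - s| * ‖x - 0‖ := hmv
      _ = L1 * ‖x - 0‖ * |s' - s| := by ring
  have hpl : ∀ t < 0, ∀ x : EuclideanSpace ℝ (Fin 3), U t x 0 = U t 0 0 ∧ U t x 2 = U t 0 2 := by
    intro t ht x
    have hc : ∀ i : Fin 3, ContinuousOn (fun s => U s x i - U s 0 i) (Iio 0) := fun i =>
      ((EuclideanSpace.proj i).continuous.comp_continuousOn (hincr x)).congr fun s _ => by simp
    refine ⟨sub_eq_zero.1 (eq_of_ae_restrict_Iio_of_continuousOn (hc 0)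
        (hplae.mono fun s hs => by rw [(hs x).1, sub_self]) ht),
      sub_eq_zero.1 (eq_of_ae_restrict_Iio_of_continuousOn (hc 2)
        (hplae.mono fun s hs => by rw [(hs x).2, sub_self]) ht)⟩
  exact repr_const_of_planar_const hbm hbC hUm hsmooth hdivU hbd hlip hvort hpl

/-! ## The printed class: KNSS's bounded weak solutions invariant along a line -/

/-- **KNSS 2009, Theorem 5.1 for `2½`-dimensional bounded weak solutions** (the printed class
`L^∞(ℝ³ × (−∞, 0))` of §4 (ii); the statement used on p. 13 in the proof of Thm 6.2). Let `u` be a bounded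
weak solution of Navier–Stokes (`ν = 1`) on `ℝ³ × (−∞, 0)` which is invariant under the translations along
the Lean coordinate `1` as an `L^∞` function: for every `δ`, `u(t, · + δe₁) = u(t, ·)` a.e. in `x`, for a.e.
`t < 0`. Then there is a bounded measurable `b : ℝ → ℝ³` with `u(t, ·) = b(t)` a.e. in `x`, for a.e.
`t < 0` (for the §4 representative `U + b(t)`, at a.e. `t` the slice `U(t, ·)` is invariant under the
rational translations, hence under all of them by density; then `repr_const_of_ae_lineInvariant`). -/
theorem boundedWeak_ae_eq_const_of_ae_lineInvariant
    {u : ℝ → EuclideanSpace ℝ (Fin 3) → EuclideanSpace ℝ (Fin 3)}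
    (hw : IsBoundedWeakNSSolutionOn (Iio 0) isOpen_Iio 1 u)
    (hinv : ∀ δ : ℝ, ∀ᵐ t ∂((volume : Measure ℝ).restrict (Iio 0)),
      (fun x => u t (x + EuclideanSpace.single 1 δ)) =ᵐ[volume] u t) :
    ∃ b : ℝ → EuclideanSpace ℝ (Fin 3), Measurable b ∧ (∃ C : ℝ, ∀ t, ‖b t‖ ≤ C) ∧
      ∀ᵐ t ∂((volume : Measure ℝ).restrict (Iio 0)), u t =ᵐ[volume] fun _ => b t := by
  classical
  obtain ⟨U, b, hbm, hbC, hUm, hae, hsmooth, hdivU, hbd, hlip, hvort⟩ :=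
    KNSS2009_regularity_boundedWeak_ancient_holds hw
  obtain ⟨C0, hC0⟩ := hbd 0
  obtain ⟨Cb, hCb⟩ := id hbC
  have hUb : ∀ t < 0, ∀ x, ‖U t x‖ ≤ C0 := fun t ht x => by
    have h := hC0 t ht x
    rwa [norm_iteratedFDeriv_zero] at h
  have hC0nn : 0 ≤ C0 := (norm_nonneg _).trans (hUb (-1) (by norm_num) 0)
  have hUc : ∀ t < 0, Continuous (U t) := fun t ht => (hsmooth t ht).continuous
  have he₁c : Continuous fun δ : ℝ => (EuclideanSpace.single 1 δ : EuclideanSpace ℝ (Fin 3)) := by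
    have h : (fun δ : ℝ => (EuclideanSpace.single 1 δ : EuclideanSpace ℝ (Fin 3))) =
        fun δ => δ • (EuclideanSpace.single 1 (1 : ℝ) : EuclideanSpace ℝ (Fin 3)) := by
      funext δ; ext i; fin_cases i <;> simp
    rw [h]
    exact continuous_id.smul continuous_const
  -- at a.e. `t`, the slice `U t` is invariant along `e₁` everywhere
  have hall : ∀ᵐ t ∂((volume : Measure ℝ).restrict (Iio 0)), ∀ q : ℚ,
      (fun x => u t (x + EuclideanSpace.single 1 (q : ℝ))) =ᵐ[volume] u t :=
    ae_all_iff.2 fun q => hinv q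
  have hUinv : ∀ᵐ t ∂((volume : Measure ℝ).restrict (Iio 0)),
      ∀ (x : EuclideanSpace ℝ (Fin 3)) (δ : ℝ), U t (x + EuclideanSpace.single 1 δ) = U t x := by
    filter_upwards [hall, hae, ae_restrict_mem measurableSet_Iio] with t ht hUt htneg
    have htneg : t < 0 := htneg
    have hrat : ∀ q : ℚ, ∀ x, U t (x + EuclideanSpace.single 1 (q : ℝ)) = U t x := by
      intro q
      have hτ : MeasurePreserving
          (fun y : EuclideanSpace ℝ (Fin 3) => y + EuclideanSpace.single 1 (q : ℝ)) volume volume :=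
        measurePreserving_add_right volume _
      have h1 : (u t ∘ fun y => y + EuclideanSpace.single 1 (q : ℝ)) =ᵐ[volume]
          ((fun x => U t x + b t) ∘ fun y => y + EuclideanSpace.single 1 (q : ℝ)) :=
        hτ.quasiMeasurePreserving.ae_eq hUt
      have h2 : (U t ∘ fun y => y + EuclideanSpace.single 1 (q : ℝ)) =ᵐ[volume] U t := by
        filter_upwards [h1, ht q, hUt] with y hy1 hy2 hy3
        simp only [Function.comp_apply] at hy1 hy2 ⊢
        have h3 : U t (y + EuclideanSpace.single 1 (q : ℝ)) + b t = U t y + b t := by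
          rw [← hy1, ← hy3, hy2]
        exact add_right_cancel h3
      have hc : Continuous (U t ∘ fun y => y + EuclideanSpace.single 1 (q : ℝ)) :=
        (hUc t htneg).comp (continuous_id.add continuous_const)
      exact congr_fun (Measure.eq_of_ae_eq h2 hc (hUc t htneg))
    intro x δ
    have hf : Continuous fun δ : ℝ => U t (x + EuclideanSpace.single 1 δ) :=
      (hUc t htneg).comp (continuous_const.add he₁c)
    have key := Continuous.ext_on (Rat.denseRange_cast (𝕜 := ℝ)) hf continuous_const
      (fun δ hδ => by
        obtain ⟨q, rfl⟩ := hδ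
        exact hrat q x)
    exact congr_fun key δ
  have hU := repr_const_of_ae_lineInvariant hw hbm hbC hUm hae hsmooth hdivU hbd hlip hvort hUinv
  -- the bounded measurable spatial constant
  refine ⟨fun t => if t < 0 then U t 0 + b t else 0, ?_, ⟨C0 + Cb, fun t => ?_⟩, ?_⟩
  · refine Measurable.ite measurableSet_Iio ?_ measurable_const
    exact (hUm.comp (measurable_id.prodMk measurable_const)).add hbm
  · show ‖(if t < 0 then U t 0 + b t else 0)‖ ≤ C0 + Cb
    by_cases ht : t < 0
    · rw [if_pos ht]; exact (norm_add_le _ _).trans (add_le_add (hUb t ht 0) (hCb t))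
    · rw [if_neg ht, norm_zero]; exact add_nonneg hC0nn ((norm_nonneg _).trans (hCb 0))
  · filter_upwards [hae, ae_restrict_mem measurableSet_Iio] with t ht htneg
    filter_upwards [ht] with y hy
    rw [hy, if_pos (mem_Iio.1 htneg), hU t htneg y]

/-- **The same along an arbitrary direction `e ≠ 0`** (KNSS's class is `O(3)`-invariant,
`IsBoundedWeakNSSolutionOn.conj_linearIsometryEquiv`; conjugate by the reflection taking `e/‖e‖` to `e₁`). -/
theorem boundedWeak_ae_eq_const_of_ae_invariant_along
    {u : ℝ → EuclideanSpace ℝ (Fin 3) → EuclideanSpace ℝ (Fin 3)} {e : EuclideanSpace ℝ (Fin 3)}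
    (he : e ≠ 0) (hw : IsBoundedWeakNSSolutionOn (Iio 0) isOpen_Iio 1 u)
    (hinv : ∀ δ : ℝ, ∀ᵐ t ∂((volume : Measure ℝ).restrict (Iio 0)),
      (fun x => u t (x + δ • e)) =ᵐ[volume] u t) :
    ∃ b : ℝ → EuclideanSpace ℝ (Fin 3), Measurable b ∧ (∃ C : ℝ, ∀ t, ‖b t‖ ≤ C) ∧
      ∀ᵐ t ∂((volume : Measure ℝ).restrict (Iio 0)), u t =ᵐ[volume] fun _ => b t := by
  set e₁ : EuclideanSpace ℝ (Fin 3) := EuclideanSpace.single 1 (1 : ℝ) with he₁_def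
  set e' : EuclideanSpace ℝ (Fin 3) := ‖e‖⁻¹ • e with he'_def
  have hne : ‖e‖ ≠ 0 := norm_ne_zero_iff.2 he
  have he' : ‖e'‖ = 1 := by rw [he'_def, norm_smul, norm_inv, norm_norm, inv_mul_cancel₀ hne]
  have he₁ : ‖e₁‖ = 1 := by simp [he₁_def]
  set R : EuclideanSpace ℝ (Fin 3) ≃ₗᵢ[ℝ] EuclideanSpace ℝ (Fin 3) :=
    Submodule.reflection (ℝ ∙ (e' - e₁))ᗮ with hR_def
  have hRe : R e' = e₁ := Submodule.reflection_sub (by rw [he', he₁])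
  have hRsymm : R.symm e₁ = e' := by rw [← hRe, LinearIsometryEquiv.symm_apply_apply]
  set v : ℝ → EuclideanSpace ℝ (Fin 3) → EuclideanSpace ℝ (Fin 3) := fun t x => R (u t (R.symm x)) with hv_def
  have hv : IsBoundedWeakNSSolutionOn (Iio 0) isOpen_Iio 1 v := hw.conj_linearIsometryEquiv R
  have hsingle : ∀ δ : ℝ, (EuclideanSpace.single 1 δ : EuclideanSpace ℝ (Fin 3)) = δ • e₁ := by
    intro δ; rw [he₁_def]; ext i; fin_cases i <;> simp
  have harg : ∀ (x : EuclideanSpace ℝ (Fin 3)) (δ : ℝ),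
      R.symm (x + EuclideanSpace.single 1 δ) = R.symm x + (δ * ‖e‖⁻¹) • e := fun x δ => by
    rw [map_add, hsingle, map_smul, hRsymm, he'_def, smul_smul]
  have hvinv : ∀ δ : ℝ, ∀ᵐ t ∂((volume : Measure ℝ).restrict (Iio 0)),
      (fun x => v t (x + EuclideanSpace.single 1 δ)) =ᵐ[volume] v t := by
    intro δ
    filter_upwards [hinv (δ * ‖e‖⁻¹)] with t ht
    have h1 : ((fun x => u t (x + (δ * ‖e‖⁻¹) • e)) ∘ R.symm) =ᵐ[volume] (u t ∘ R.symm) :=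
      R.symm.measurePreserving.quasiMeasurePreserving.ae_eq ht
    filter_upwards [h1] with y hy
    simp only [Function.comp_apply] at hy
    show R (u t (R.symm (y + EuclideanSpace.single 1 δ))) = R (u t (R.symm y))
    rw [harg, hy]
  obtain ⟨b, hbm, ⟨C, hC⟩, hb⟩ := boundedWeak_ae_eq_const_of_ae_lineInvariant hv hvinv
  refine ⟨fun t => R.symm (b t), R.symm.continuous.measurable.comp hbm,
    ⟨C, fun t => by rw [LinearIsometryEquiv.norm_map]; exact hC t⟩, ?_⟩
  filter_upwards [hb] with t ht
  have h1 : (v t ∘ R) =ᵐ[volume] ((fun _ => b t) ∘ R) :=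
    R.measurePreserving.quasiMeasurePreserving.ae_eq ht
  filter_upwards [h1] with y hy
  simp only [Function.comp_apply, hv_def, LinearIsometryEquiv.symm_apply_apply] at hy
  rw [← hy, LinearIsometryEquiv.symm_apply_apply]

/-! ## Census row A7b (printed class) -/

/-- Census row A7b — printed-class twin of A7 (any bounded type · 2.5D as an `L^∞` function: for every
`δ`, `u(t, · + δe₃) = u(t, ·)` a.e. in `x` for a.e. `t < 0` · bounded WEAK ancient solution of KNSS 2009,
§4 (ii), `ν = 1`): `u(t, ·) = b(t)` a.e. for a.e. `t < 0`, with `b` bounded measurable — KNSS Thm 5.1 one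
dimension up, as used on p. 13 of the printed proof of Thm 6.2. Value: EXCLUDED-IN-TREE
(`row_A7b_excluded`). -/
def Row_A7b : Prop :=
  ∀ u : ℝ → EuclideanSpace ℝ (Fin 3) → EuclideanSpace ℝ (Fin 3),
    FluidPDE.IsBoundedWeakNSSolutionOn (Iio 0) isOpen_Iio 1 u →
      (∀ δ : ℝ, ∀ᵐ t ∂((volume : Measure ℝ).restrict (Iio 0)),
          (fun x => u t (x + δ • EuclideanSpace.single 2 (1 : ℝ))) =ᵐ[volume] u t) →
        ∃ b : ℝ → EuclideanSpace ℝ (Fin 3), Measurable b ∧ (∃ C : ℝ, ∀ t, ‖b t‖ ≤ C) ∧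
          ∀ᵐ t ∂((volume : Measure ℝ).restrict (Iio 0)), u t =ᵐ[volume] fun _ => b t

/-- A7b is EXCLUDED-IN-TREE: `boundedWeak_ae_eq_const_of_ae_invariant_along` with `e = e₃`. -/
theorem row_A7b_excluded : Row_A7b := by
  intro u hw hinv
  have he : (EuclideanSpace.single 2 (1 : ℝ) : EuclideanSpace ℝ (Fin 3)) ≠ 0 := by
    intro h0
    have : (EuclideanSpace.single 2 (1 : ℝ) : EuclideanSpace ℝ (Fin 3)) 2 = 0 := by rw [h0]; rfl
    simp at this
  exact boundedWeak_ae_eq_const_of_ae_invariant_along he hw hinv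

end Summit.NavierStokesRegularity.NavierStokesRegularity.Theorems.ScenarioCensus

end
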